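import Mathlib
import Summits.AtomisticToContinuum.HydrodynamicLimit.Theses.ImplosionDichotomy

/-!
# Sketch — crux-ideate stmt-AtomisticToContinuum-12586 (`DenseExcursion`), ideator 2, round 1

First-lemma signatures for the idea cards in `Ideas/`:

* `PolynomialCompressionAt κ` / `UntunedCompressionR2` — card `r2-one-mode-two-conditions`:
  the untuned modulation rung predicted by the computed race
  (κ* = 9 (r₂ − 1) / Λ₁(r₂) ≈ 1.274 for the first smooth γ = 5/3 spherical profile).
* `sonicPoint_monatomic_closedForm` — card `kidder-knob-melnikov`: for the monatomic
  gas in `d = 3` (`ℓ = 2/(γ-1) = 3 = d`) the sonic point `P₂(r)` of the Merle–Raphaël–Rodnianski–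
  Szeftel / Biasi phase portrait is ALGEBRAIC IN CLOSED FORM, `W₂ = (r - √(r² - 6r + 6))/2`,
  `S₂ = 1 - W₂` (both `Δ₁` and `Δ₂` reduce to the quadratic `2W² - 2rW + 3(r-1)`); this is the
  exact starting datum of every Taylor/shooting/interval-arithmetic computation of the line (PROVED
  below, no sorry).
* `ConeLocality` — the domain-of-dependence statement that makes the admissible σ-solution exactly
  radial inside the backward acoustic cone (selection rule used by both cards).
-/

namespace Summit.AtomisticToContinuum.HydrodynamicLimit.Cruxes.DenseExcursion.Sketch

open Literature.MathematicalPhysics.KineticTheory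
open Summit.AtomisticToContinuum.HydrodynamicLimit.Theses.ImplosionDichotomy

/-- Admissibility of a classical hard-sphere-Euler solution for profiles `(a₀,u₀,θ₀)` at reduced
diameter `σ`: the `t = 0` fields are the LLN limit of the local Gibbs laws for every flow family
(the tie used verbatim in `DenseExcursion`). -/
def Admissible (σ : ℝ) (a₀ θ₀ : T3 → ℝ) (u₀ : T3 → V3) (T : ℝ) (ρ θ : ℝ → T3 → ℝ)
    (u : ℝ → T3 → V3) : Prop :=
  IsHardSphereEulerSolution σ T ρ u θ ∧
    ∀ Φ : (N : ℕ) → Literature.Analysis.FluidPDE.HardSphereFlow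
        (Literature.Analysis.FluidPDE.Torus.geometry (Fin 3)) (hsDiameter σ N) (N + 1),
      TendstoHydroFieldsAt (fun N => localGibbsLaw σ a₀ u₀ θ₀ N (Φ N)) Φ ρ u θ 0

/-- `PolynomialCompression` of the route with the exponent made explicit: some admissible
σ-solution from fixed continuous positive profiles reaches density `σ^{-κ}` along a sequence
`σ → 0`.  `κ = 3` (packing `O(1)`) is (up to the constant `η`) `DenseExcursion`. -/
def PolynomialCompressionAt (κ : ℝ) : Prop :=
  ∃ (a₀ θ₀ : T3 → ℝ) (u₀ : T3 → V3), Continuous a₀ ∧ Continuous θ₀ ∧ Continuous u₀ ∧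
    (∀ x, 0 < a₀ x) ∧ (∀ x, 0 < θ₀ x) ∧
    ∀ σ₀ : ℝ, 0 < σ₀ → ∃ σ : ℝ, 0 < σ ∧ σ < σ₀ ∧
      ∃ (T : ℝ) (ρ θ : ℝ → T3 → ℝ) (u : ℝ → T3 → V3), Admissible σ a₀ θ₀ u₀ T ρ θ u ∧
        ∃ t ∈ Set.Ico 0 T, ∃ x, σ ^ (-κ) ≤ ρ t x

/-- FIRST LEMMA of card `r2-one-mode-two-conditions` (the untuned rung): modulation-only forced
stability of the first smooth spherical γ = 5/3 implosion profile `SS(r₂)`, `r₂ ≈ 1.112816`,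
under the O(packing) excluded-volume forcing gives density `σ^{-κ}` for every
`κ < κ* = 9(r₂-1)/Λ₁(r₂) ≈ 1.274` (computed this seat: single genuine unstable smooth radial mode
`Λ₁ ≈ 0.797`, packing clock `3(r₂-1) ≈ 0.338`).  Stated at `κ = 1`. -/
def UntunedCompressionR2 : Prop := PolynomialCompressionAt 1

/-- The route's `PolynomialCompression` follows from any fixed positive exponent. -/
theorem polynomialCompression_of_at {κ : ℝ} (hκ : 0 < κ) (h : PolynomialCompressionAt κ) :
    PolynomialCompression := by
  obtain ⟨a₀, θ₀, u₀, ha, hθ, hu, ha0, hθ0, H⟩ := h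
  refine ⟨κ, hκ, a₀, θ₀, u₀, ha, hθ, hu, ha0, hθ0, ?_⟩
  intro σ₀ hσ₀
  obtain ⟨σ, hσ, hσlt, T, ρ, θ, u, ⟨hE, hΦ⟩, t, ht, x, hx⟩ := H σ₀ hσ₀
  exact ⟨σ, hσ, hσlt, T, ρ, θ, u, hE, hΦ, t, ht, x, hx⟩

/-- The ONE-CONDITION RUNG of card `kidder-knob-melnikov`: dense excursions at arbitrarily small `σ` for
profiles ALLOWED TO DEPEND on `σ` (what a transversal zero of the first Melnikov function along the Kidder
knob gives: each profile `P_b`, `b → b₀`, has one good `σ*(b) → 0`).  Logically weaker than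
`DenseExcursion` (it does not refute the profile-wise `DiluteSelfConsistency`; it refutes only a
uniform-in-profiles dilute bound). -/
def DenseExcursionMovingProfile : Prop :=
  ∃ η : ℝ, 0 < η ∧ ∀ σ₀ : ℝ, 0 < σ₀ →
    ∃ (a₀ θ₀ : T3 → ℝ) (u₀ : T3 → V3), Continuous a₀ ∧ Continuous θ₀ ∧ Continuous u₀ ∧
      (∀ x, 0 < a₀ x) ∧ (∀ x, 0 < θ₀ x) ∧
      ∃ σ : ℝ, 0 < σ ∧ σ < σ₀ ∧
        ∃ (T : ℝ) (ρ θ : ℝ → T3 → ℝ) (u : ℝ → T3 → V3), Admissible σ a₀ θ₀ u₀ T ρ θ u ∧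
          ∃ t ∈ Set.Ico 0 T, ∃ x, η ≤ ρ t x * σ ^ 3

/-- The rung is implied by the crux (fix the profile). -/
theorem movingProfile_of_denseExcursion (h : DenseExcursion) : DenseExcursionMovingProfile := by
  obtain ⟨η, hη, a₀, θ₀, u₀, ha, hθ, hu, ha0, hθ0, H⟩ := h
  refine ⟨η, hη, fun σ₀ hσ₀ => ⟨a₀, θ₀, u₀, ha, hθ, hu, ha0, hθ0, ?_⟩⟩
  obtain ⟨σ, hσ, hσlt, T, ρ, θ, u, hE, hΦ, t, ht, x, hx⟩ := H σ₀ hσ₀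
  exact ⟨σ, hσ, hσlt, T, ρ, θ, u, ⟨hE, hΦ⟩, t, ht, x, hx⟩

/-! ### The monatomic sonic point in closed form (card `kidder-knob-melnikov`) -/

/-- `Δ₁` of the MRRS/Biasi autonomous phase-portrait system for `(d, ℓ) = (3, 3)`
(`γ = 5/3`): `Δ₁ = W(W-1)(W-r) - d (W - e) S²`, `e = ℓ(r-1)/d = r - 1`. -/
def Delta1mono (r S W : ℝ) : ℝ := W * (W - 1) * (W - r) - 3 * (W - (r - 1)) * S ^ 2

/-- `ℓ Δ₂ / S` of the same system for `(d, ℓ) = (3, 3)`: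
`(ℓ+d-1)W² - (ℓ+d+(ℓ-1)r)W + ℓr - ℓS² = 5W² - (6+2r)W + 3r - 3S²`. -/
def Delta2monoBracket (r S W : ℝ) : ℝ := 5 * W ^ 2 - (6 + 2 * r) * W + 3 * r - 3 * S ^ 2

/-- FIRST LEMMA of card `kidder-knob-melnikov`, PROVED: on the sonic line `S = 1 - W`
both `Δ₁` and the `Δ₂`-bracket of the monatomic (`ℓ = d = 3`) system vanish at
`W₂ = (r - √(r² - 6r + 6))/2` whenever `r² - 6r + 6 ≥ 0`, i.e. `r ≤ r* = 3 - √3 ≈ 1.268`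
(the merging point `P₂ = P₃`, which is exactly the CaoLabora et al. bound `r*(5/3)`).  Hence the
eye `P₂` of every γ = 5/3 spherical implosion profile is an explicit algebraic point. -/
theorem sonicPoint_monatomic_closedForm (r : ℝ) (h : 0 ≤ r ^ 2 - 6 * r + 6) :
    Delta1mono r (1 - (r - Real.sqrt (r ^ 2 - 6 * r + 6)) / 2)
        ((r - Real.sqrt (r ^ 2 - 6 * r + 6)) / 2) = 0 ∧
      Delta2monoBracket r (1 - (r - Real.sqrt (r ^ 2 - 6 * r + 6)) / 2)
        ((r - Real.sqrt (r ^ 2 - 6 * r + 6)) / 2) = 0 := by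
  set s := Real.sqrt (r ^ 2 - 6 * r + 6) with hs_def
  have hs : s ^ 2 = r ^ 2 - 6 * r + 6 := by
    rw [hs_def, Real.sq_sqrt h]
  set W := (r - s) / 2 with hW
  have hq : 2 * W ^ 2 - 2 * r * W + 3 * (r - 1) = 0 := by
    rw [hW]; linear_combination (1 / 2 : ℝ) * hs
  constructor
  · unfold Delta1mono
    linear_combination (1 - W) * hq
  · unfold Delta2monoBracket
    linear_combination hq

/-! ### Cone locality (selection rule: the admissible σ-solution is radial inside the cone) -/

/-- Domain of dependence for classical hard-sphere-Euler solutions on `𝕋³` (minimal-image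
distance `Torus.euclidDist`): two classical solutions at the same `σ` whose data agree on a ball
agree inside the backward cone of some finite signal speed `V` (depending on the two solutions).
With radial-in-a-ball data this makes the solution exactly radial in the cone, so non-radial
unstable modes of the implosion profile are never excited and only Biasi's RADIAL smooth modes
enter the race. -/
def ConeLocality : Prop :=
  ∀ (σ T : ℝ) (ρ₁ θ₁ ρ₂ θ₂ : ℝ → T3 → ℝ) (u₁ u₂ : ℝ → T3 → V3),
    IsHardSphereEulerSolution σ T ρ₁ u₁ θ₁ → IsHardSphereEulerSolution σ T ρ₂ u₂ θ₂ →
    ∃ V : ℝ, 0 < V ∧ ∀ (x₀ : T3) (R : ℝ), 0 < R → R < 1 / 2 →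
      (∀ x, Literature.Analysis.FluidPDE.Torus.euclidDist x x₀ < R →
          ρ₁ 0 x = ρ₂ 0 x ∧ u₁ 0 x = u₂ 0 x ∧ θ₁ 0 x = θ₂ 0 x) →
      ∀ t ∈ Set.Ico 0 T, ∀ x, Literature.Analysis.FluidPDE.Torus.euclidDist x x₀ < R - V * t →
          ρ₁ t x = ρ₂ t x ∧ u₁ t x = u₂ t x ∧ θ₁ t x = θ₂ t x

end Summit.AtomisticToContinuum.HydrodynamicLimit.Cruxes.DenseExcursion.Sketch
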